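import Mathlib
import HarnessLib

/-!
# The cumulative net flux `W(t,R) = ∫₀ᴿ w(t,r) dr` on a backward window: integrability, `∂_R W = w`, growth, joint continuity
# (support file for NF-4ᵛ `stub_windowDecay_viscosity` of the netflux line on crux `PoloidalLiouville`, stmt-NavierStokesRegularity-1222, W1)

ARM A `pub/ns-exp-scalarLiouville` g3.  Pure real analysis about an ABSTRACT density `w : ℝ → ℝ → ℝ` on a window `(t₀,0) × (0,∞)`
under the two facts the line supplies for the net flux density `w(t,r) = netFlux (T t) x₀ r`:
* joint continuity on `(t₀,0) × (0,∞)` (first conjunct of (L) `OneSidedNetFluxLaw`), and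
* the a-priori Type-I bound `0 ≤ w(t,r) ≤ K·r/(−t)` for `r > 0` (NF-0 `OscLeVorticity` + `‖ω‖ ≤ C₁/(−t)`, `K = π C₁`).
Conclusions (step (WD)(1),(2),(ρ) of the line's derivation): `w(t,·)` is interval-integrable on `[0,∞)`; `R ↦ ∫₀ᴿ w(t,r) dr` has
derivative `w(t,R)` at every `R > 0`; `0 ≤ ∫₀ᴿ w(t,r) dr ≤ K R²/(2(−t))`; the substitution `∫₀ᴿ w(t,r) dr = ∫₀¹ R·w(t,Rθ) dθ`; and
`(t,R) ↦ ∫₀ᴿ w(t,r) dr` is jointly continuous on `(t₀,0) × [0,∞)` (dominated convergence after the substitution).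
Nothing here is about Navier–Stokes.  [folklore]
-/

-- the summit and its single problem share the name (D-0017 nested layout)
set_option linter.dupNamespace false

noncomputable section

open Set Filter Topology MeasureTheory intervalIntegral

namespace Summit.NavierStokesRegularity.NavierStokesRegularity.Theorems.PoloidalLiouville.NetFlux

variable {w : ℝ → ℝ → ℝ} {t₀ K : ℝ}

/-- Time slices of a jointly continuous density are continuous on `(0,∞)`. -/
theorem window_slice_continuousOn (hcont : ContinuousOn (fun p : ℝ × ℝ => w p.1 p.2) (Ioo t₀ 0 ×ˢ Ioi 0)) {t : ℝ}
    (ht : t ∈ Ioo t₀ 0) : ContinuousOn (w t) (Ioi 0) :=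
  hcont.comp (Continuous.prodMk_right t).continuousOn fun _ hr => ⟨ht, hr⟩

/-- The constant in the a-priori bound is nonnegative (the window is nonempty). -/
theorem window_const_nonneg (ht₀ : t₀ < 0)
    (hbd : ∀ t ∈ Ioo t₀ 0, ∀ r, 0 < r → 0 ≤ w t r ∧ w t r ≤ K * r / (-t)) : 0 ≤ K := by
  obtain ⟨t, ht⟩ : (Ioo t₀ 0).Nonempty := nonempty_Ioo.2 ht₀
  have h := hbd t ht 1 one_pos
  have hnt : 0 < -t := by linarith [ht.2]
  have h1 : 0 ≤ K * 1 / (-t) := h.1.trans h.2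
  rw [mul_one] at h1
  by_contra hK
  push Not at hK
  have : K / (-t) < 0 := div_neg_of_neg_of_pos hK hnt
  linarith

/-- `w(t,·)` is integrable on `(0,M]` (continuous and bounded there). -/
theorem window_integrableOn_Ioc (hcont : ContinuousOn (fun p : ℝ × ℝ => w p.1 p.2) (Ioo t₀ 0 ×ˢ Ioi 0))
    (hbd : ∀ t ∈ Ioo t₀ 0, ∀ r, 0 < r → 0 ≤ w t r ∧ w t r ≤ K * r / (-t)) {t : ℝ} (ht : t ∈ Ioo t₀ 0) (M : ℝ) :
    IntegrableOn (w t) (Ioc 0 M) := by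
  have hK : 0 ≤ K := window_const_nonneg (lt_trans ht.1 ht.2) hbd
  have hnt : 0 < -t := by linarith [ht.2]
  have hmeas : AEStronglyMeasurable (w t) (volume.restrict (Ioc 0 M)) :=
    ((window_slice_continuousOn hcont ht).mono Ioc_subset_Ioi_self).aestronglyMeasurable measurableSet_Ioc
  haveI : IsFiniteMeasure (volume.restrict (Ioc (0 : ℝ) M)) :=
    isFiniteMeasure_restrict.2 (by simp [Real.volume_Ioc])
  have hint : Integrable (fun _ : ℝ => K * M / (-t)) (volume.restrict (Ioc 0 M)) := integrable_const _
  refine hint.mono' hmeas ?_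
  rw [ae_restrict_iff' measurableSet_Ioc]
  refine Eventually.of_forall fun r hr => ?_
  have h := hbd t ht r hr.1
  rw [Real.norm_eq_abs, abs_of_nonneg h.1]
  calc w t r ≤ K * r / (-t) := h.2
    _ ≤ K * M / (-t) := by
        apply div_le_div_of_nonneg_right _ hnt.le
        exact mul_le_mul_of_nonneg_left hr.2 hK

/-- `w(t,·)` is interval-integrable between any two points of `[0,∞)`. -/
theorem window_intervalIntegrable (hcont : ContinuousOn (fun p : ℝ × ℝ => w p.1 p.2) (Ioo t₀ 0 ×ˢ Ioi 0))
    (hbd : ∀ t ∈ Ioo t₀ 0, ∀ r, 0 < r → 0 ≤ w t r ∧ w t r ≤ K * r / (-t)) {t : ℝ} (ht : t ∈ Ioo t₀ 0) {a b : ℝ}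
    (ha : 0 ≤ a) (hb : 0 ≤ b) : IntervalIntegrable (w t) volume a b := by
  rw [intervalIntegrable_iff]
  have h := window_integrableOn_Ioc hcont hbd ht (max a b)
  exact h.mono_set (Ioc_subset_Ioc (le_min ha hb) le_rfl)

/-- **`∂_R ∫₀ᴿ w(t,r) dr = w(t,R)` at every `R > 0`** (FTC-1, `w(t,·)` continuous at `R`). -/
theorem hasDerivAt_window_primitive (hcont : ContinuousOn (fun p : ℝ × ℝ => w p.1 p.2) (Ioo t₀ 0 ×ˢ Ioi 0))
    (hbd : ∀ t ∈ Ioo t₀ 0, ∀ r, 0 < r → 0 ≤ w t r ∧ w t r ≤ K * r / (-t)) {t : ℝ} (ht : t ∈ Ioo t₀ 0) {R : ℝ}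
    (hR : 0 < R) : HasDerivAt (fun S => ∫ r in (0 : ℝ)..S, w t r) (w t R) R :=
  integral_hasDerivAt_right (window_intervalIntegrable hcont hbd ht le_rfl hR.le)
    ((window_slice_continuousOn hcont ht).stronglyMeasurableAtFilter isOpen_Ioi R hR)
    ((window_slice_continuousOn hcont ht).continuousAt (Ioi_mem_nhds hR))

/-- `0 ≤ ∫₀ᴿ w(t,r) dr` for `R ≥ 0`. -/
theorem window_primitive_nonneg (hcont : ContinuousOn (fun p : ℝ × ℝ => w p.1 p.2) (Ioo t₀ 0 ×ˢ Ioi 0))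
    (hbd : ∀ t ∈ Ioo t₀ 0, ∀ r, 0 < r → 0 ≤ w t r ∧ w t r ≤ K * r / (-t)) {t : ℝ} (ht : t ∈ Ioo t₀ 0) {R : ℝ}
    (hR : 0 ≤ R) : 0 ≤ ∫ r in (0 : ℝ)..R, w t r := by
  have h := integral_mono_on_of_le_Ioo (μ := volume) hR intervalIntegrable_const
    (window_intervalIntegrable hcont hbd ht le_rfl hR) (f := fun _ => (0 : ℝ)) (g := w t)
    (fun r hr => (hbd t ht r hr.1).1)
  simpa using h

/-- **Growth: `∫₀ᴿ w(t,r) dr ≤ K R²/(2(−t))`** for `R ≥ 0`. -/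
theorem window_primitive_le (hcont : ContinuousOn (fun p : ℝ × ℝ => w p.1 p.2) (Ioo t₀ 0 ×ˢ Ioi 0))
    (hbd : ∀ t ∈ Ioo t₀ 0, ∀ r, 0 < r → 0 ≤ w t r ∧ w t r ≤ K * r / (-t)) {t : ℝ} (ht : t ∈ Ioo t₀ 0) {R : ℝ}
    (hR : 0 ≤ R) : ∫ r in (0 : ℝ)..R, w t r ≤ K / (-t) * R ^ 2 / 2 := by
  have h := integral_mono_on_of_le_Ioo (μ := volume) hR (window_intervalIntegrable hcont hbd ht le_rfl hR)
    (f := w t) (g := fun r => K / (-t) * r) ((continuous_const.mul continuous_id).intervalIntegrable _ _)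
    (fun r hr => by have := (hbd t ht r hr.1).2; rw [div_mul_eq_mul_div]; exact this)
  calc ∫ r in (0 : ℝ)..R, w t r ≤ ∫ r in (0 : ℝ)..R, K / (-t) * r := h
    _ = K / (-t) * R ^ 2 / 2 := by rw [intervalIntegral.integral_const_mul, integral_id]; ring

/-- **Substitution `r = Rθ`: `∫₀ᴿ w(t,r) dr = ∫₀¹ R·w(t,Rθ) dθ`** (for every real `R`, also `R ≤ 0`). -/
theorem window_primitive_eq_unit (t R : ℝ) :
    ∫ r in (0 : ℝ)..R, w t r = ∫ θ in (0 : ℝ)..1, R * w t (R * θ) := by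
  rw [intervalIntegral.integral_const_mul, ← smul_eq_mul, intervalIntegral.smul_integral_comp_mul_left]
  simp

/-- **Joint continuity of `(t,R) ↦ ∫₀ᴿ w(t,r) dr` on `(t₀,0) × [0,∞)`** (dominated convergence after the substitution `r = Rθ`;
at `R = 0` the a-priori bound `w ≤ K r/(−t)` squeezes the integrand). -/
theorem continuousOn_window_primitive (hcont : ContinuousOn (fun p : ℝ × ℝ => w p.1 p.2) (Ioo t₀ 0 ×ˢ Ioi 0))
    (hbd : ∀ t ∈ Ioo t₀ 0, ∀ r, 0 < r → 0 ≤ w t r ∧ w t r ≤ K * r / (-t)) :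
    ContinuousOn (fun p : ℝ × ℝ => ∫ r in (0 : ℝ)..p.2, w p.1 r) (Ioo t₀ 0 ×ˢ Ici 0) := by
  have hfun : (fun p : ℝ × ℝ => ∫ r in (0 : ℝ)..p.2, w p.1 r)
      = fun p : ℝ × ℝ => ∫ θ in (0 : ℝ)..1, p.2 * w p.1 (p.2 * θ) := by
    funext p; exact window_primitive_eq_unit p.1 p.2
  rw [hfun]
  rintro ⟨t', R'⟩ ⟨ht', hR'⟩
  have hR'0 : 0 ≤ R' := hR'
  have hnt' : 0 < -t' := by linarith [ht'.2]
  have hK : 0 ≤ K := window_const_nonneg (lt_trans ht'.1 ht'.2) hbd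
  set S : Set (ℝ × ℝ) := Ioo t₀ 0 ×ˢ Ici 0 with hS_def
  set B : ℝ := (R' + 1) * (K * (R' + 1) / (-t' / 2)) with hB_def
  have hB : 0 ≤ B := by rw [hB_def]; positivity
  -- a neighbourhood within `S` on which the integrands are uniformly bounded
  have hN : ∀ᶠ p in 𝓝[S] ((t', R') : ℝ × ℝ), p ∈ S ∧ p.1 < t' / 2 ∧ p.2 < R' + 1 := by
    have h1 : ∀ᶠ p in 𝓝 ((t', R') : ℝ × ℝ), p.1 < t' / 2 ∧ p.2 < R' + 1 := by
      have ha : ∀ᶠ p in 𝓝 ((t', R') : ℝ × ℝ), p.1 < t' / 2 :=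
        (continuous_fst.tendsto _).eventually (Iio_mem_nhds (by simp; linarith [ht'.2]))
      have hb : ∀ᶠ p in 𝓝 ((t', R') : ℝ × ℝ), p.2 < R' + 1 :=
        (continuous_snd.tendsto _).eventually (Iio_mem_nhds (by simp))
      exact ha.and hb
    filter_upwards [self_mem_nhdsWithin, mem_nhdsWithin_of_mem_nhds h1] with p hp hq using ⟨hp, hq⟩
  -- pointwise bound on that neighbourhood
  have hptw : ∀ p : ℝ × ℝ, p ∈ S → p.1 < t' / 2 → p.2 < R' + 1 → ∀ θ ∈ Ioc (0 : ℝ) 1,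
      0 ≤ p.2 * w p.1 (p.2 * θ) ∧ p.2 * w p.1 (p.2 * θ) ≤ p.2 ^ 2 * (K / (-t' / 2)) ∧
        p.2 * w p.1 (p.2 * θ) ≤ B := by
    rintro ⟨t, R⟩ ⟨ht, hR⟩ h1 h2 θ hθ
    have hR0 : 0 ≤ R := hR
    simp only at h1 h2 ⊢
    have hnt : -t' / 2 ≤ -t := by linarith
    rcases hR0.eq_or_lt with h | hRpos
    · rw [← h]; simp only [zero_mul, le_refl, true_and]
      constructor
      · simp
      · exact hB
    · have hb := hbd t ht (R * θ) (mul_pos hRpos hθ.1)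
      have hup : w t (R * θ) ≤ K * R / (-t' / 2) := by
        calc w t (R * θ) ≤ K * (R * θ) / (-t) := hb.2
          _ ≤ K * R / (-t) := by
              apply div_le_div_of_nonneg_right _ (by linarith)
              calc K * (R * θ) ≤ K * (R * 1) := by
                    apply mul_le_mul_of_nonneg_left _ hK; exact mul_le_mul_of_nonneg_left hθ.2 hR0
                _ = K * R := by ring
          _ ≤ K * R / (-t' / 2) := by
              apply div_le_div_of_nonneg_left (mul_nonneg hK hR0) (by linarith) hnt
      refine ⟨mul_nonneg hR0 hb.1, ?_, ?_⟩
      · calc R * w t (R * θ) ≤ R * (K * R / (-t' / 2)) := mul_le_mul_of_nonneg_left hup hR0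
          _ = R ^ 2 * (K / (-t' / 2)) := by ring
      · calc R * w t (R * θ) ≤ R * (K * R / (-t' / 2)) := mul_le_mul_of_nonneg_left hup hR0
          _ ≤ (R' + 1) * (K * (R' + 1) / (-t' / 2)) := by
              apply mul_le_mul h2.le _ (by positivity) (by positivity)
              apply div_le_div_of_nonneg_right _ (by linarith)
              exact mul_le_mul_of_nonneg_left h2.le hK
  -- continuity of each integrand slice on `(0,1]` for `p ∈ S`
  have hslice : ∀ p : ℝ × ℝ, p ∈ S → ContinuousOn (fun θ : ℝ => p.2 * w p.1 (p.2 * θ)) (Ioc 0 1) := by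
    rintro ⟨t, R⟩ ⟨ht, hR⟩
    have hR0 : 0 ≤ R := hR
    rcases hR0.eq_or_lt with h | hRpos
    · rw [← h]; simp only [zero_mul]; exact continuousOn_const
    · refine continuousOn_const.mul ((window_slice_continuousOn hcont ht).comp (by fun_prop) ?_)
      intro θ hθ; exact mul_pos hRpos hθ.1
  refine intervalIntegral.continuousWithinAt_of_dominated_interval (bound := fun _ => B) ?_ ?_ ?_ ?_
  · filter_upwards [hN] with p hp
    have h := (hslice p hp.1).aestronglyMeasurable (μ := volume) measurableSet_Ioc
    rwa [uIoc_of_le zero_le_one]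
  · filter_upwards [hN] with p hp
    refine Eventually.of_forall fun θ hθ => ?_
    rw [uIoc_of_le zero_le_one] at hθ
    have h := hptw p hp.1 hp.2.1 hp.2.2 θ hθ
    rw [Real.norm_eq_abs, abs_of_nonneg h.1]
    exact h.2.2
  · exact intervalIntegrable_const
  · refine Eventually.of_forall fun θ hθ => ?_
    rw [uIoc_of_le zero_le_one] at hθ
    rcases hR'0.eq_or_lt with h | hRpos
    · -- squeeze at `R' = 0`
      subst h
      show Tendsto _ _ _
      simp only [zero_mul]
      have hup : Tendsto (fun p : ℝ × ℝ => p.2 ^ 2 * (K / (-t' / 2))) (𝓝[S] ((t', (0 : ℝ)) : ℝ × ℝ)) (𝓝 0) := by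
        have hc : Continuous (fun p : ℝ × ℝ => p.2 ^ 2 * (K / (-t' / 2))) := by fun_prop
        have := (hc.tendsto ((t', (0 : ℝ)) : ℝ × ℝ)).mono_left (nhdsWithin_le_nhds (s := S))
        simpa using this
      refine tendsto_of_tendsto_of_tendsto_of_le_of_le' tendsto_const_nhds hup ?_ ?_
      · filter_upwards [hN] with p hp using (hptw p hp.1 hp.2.1 hp.2.2 θ hθ).1
      · filter_upwards [hN] with p hp using (hptw p hp.1 hp.2.1 hp.2.2 θ hθ).2.1
    · have hθR : 0 < R' * θ := mul_pos hRpos hθ.1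
      have hwc : ContinuousAt (fun p : ℝ × ℝ => w p.1 p.2) (t', R' * θ) :=
        hcont.continuousAt ((isOpen_Ioo.prod isOpen_Ioi).mem_nhds ⟨ht', hθR⟩)
      have hmap : ContinuousAt (fun p : ℝ × ℝ => ((p.1, p.2 * θ) : ℝ × ℝ)) (t', R') := by fun_prop
      have hcomp : ContinuousAt (fun p : ℝ × ℝ => w p.1 (p.2 * θ)) (t', R') :=
        ContinuousAt.comp (g := fun p : ℝ × ℝ => w p.1 p.2) (by simpa using hwc) hmap
      exact ((continuous_snd.continuousAt).mul hcomp).continuousWithinAt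

end Summit.NavierStokesRegularity.NavierStokesRegularity.Theorems.PoloidalLiouville.NetFlux

end
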